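import Literature.Analysis.FluidPDE.LocalLerayPressureDecompositionProofs
import HarnessLib

/-!
# The difference of two Riesz-transform pressures: the bilinear Calderón–Zygmund bound

Analysis/FluidPDE proof file (theorems only, everything PROVED, no definitions, no named facts)
on the inline proof path of the named fact
`Literature.Analysis.FluidPDE.local_leray_weak_strong_uniqueness` (**U**; P. G. Lemarié-Rieusset,
*The Navier–Stokes Problem in the 21st Century* (2016), **Thm. 14.7**, weak–strong uniqueness for
local Leray solutions, held copy file pp. 514–518), part "pressure estimates" of the printed
proof (pp. 516–517).

In the printed proof the pressure of the difference `w = u₁ - u₂` of two local Leray solutions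
is written near a centre `x₀` as `q_{x₀} = R₁ + R₂ + S₁ + S₂` with
`ℍ = w ⊗ u₁ + u₁ ⊗ w - w ⊗ w = u₁ ⊗ u₁ - u₂ ⊗ u₂`, the near-field terms being
`(1/Δ)∇ ⊗ ∇ (1_{B(x₀,5R₀)} ℍ)` ("we find `∫₀ᵗ∫(w·∇φ)(R₁ + R₂) ≤ Cδ(t)³ + …`" by the
Calderón–Zygmund inequality, p. 517). The tree realises the near field of the local pressure
expansion of ONE local Leray solution `(v, π)` as the Riesz-transform pressure
`p̃[1_{B_{2r}(x₀)} v(t)]` of the cut-off slice (`localPressureNear`,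
`LocalLerayPressureDecomposition.lean`; Kang–Miura–Tsai 2021, Lemma 3.4), a *quadratic*
expression, with the quadratic Calderón–Zygmund bound `‖p̃[w]‖_p ≤ C‖|w|²‖_p`
(`stein1970_normalisedPressure_ae_Lp_bound_holds`). The weak–strong argument needs the
**difference** `p̃[a] - p̃[b]` of the near fields of the two solutions controlled by the
**product** `|a - b| · |a + b|` — the bilinear form of the Calderón–Zygmund inequality for the
nine Riesz-type kernels, applied to the scalar densities `(a - b)ᵢ (a + b)ⱼ` (Stein 1970, Ch. II
§4.2 Thm. 3 with §4.5 Thm. 4, exactly as in the quadratic case). This file proves it: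

* §1 `pressureKernel_sub_eq_pressureForm` — `K(z)(a) - K(z)(b) = B_z(a - b, a + b)` for the
  symmetric bilinear form `B_z` of the kernel (`pressureForm`), and the expansion of
  `B_z(f(y), g(y))` along an orthonormal basis into the scalar densities `fᵢ gⱼ`;
* §2 the truncated bilinear singular integrals `∫_{|x-y|>ε} B_{x-y}(f(y), g(y)) dy` for
  measurable `f, g` with `|f||g| ∈ L^p`, `1 < p < ∞`: absolute convergence, the expression as
  `½ Σᵢⱼ (T^{bᵢ+bⱼ}_ε - T^{bᵢ}_ε - T^{bⱼ}_ε)(fᵢ gⱼ)` through the tree's directional truncations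
  `rieszTrunc`, measurability, the bound `‖·‖_p ≤ (27/2) A_p ‖|f||g|‖_p` (Thm. 3 (a)), the a.e.
  existence of the limit `ε → 0⁺` (Thm. 4 (a)) and, by Fatou, the same `L^p` bound for the limit
  (`exists_bilinear_pv`);
* §3 `exists_normalisedPressure_sub_eq_add₃` — **the decomposition used by the weak–strong
  argument**: for measurable `a, b, e` with `|a|², |b|² ∈ L^{3/2}` (so that both principal values
  exist a.e.), `|a - b||e| ∈ L²` and `|a - b||a - e| ∈ L²`,
  `p̃[a] - p̃[b] = Q₁ + Q₂ + Q₃` a.e. with `‖Q₁‖₂ ≤ C‖|a-b||e|‖₂`, `‖Q₂‖₂ ≤ C‖|a-b||a-e|‖₂`,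
  `‖Q₃‖_{3/2} ≤ C‖|a-b|²‖_{3/2}`, `C` absolute (write `a + b = 2e + 2(a - e) - (a - b)` in the
  second slot; in the application `a = 1_S u₁(t)`, `b = 1_S u₂(t)`, `e = 1_S u₃(t)`,
  `a - e = 1_S u₄(t)`, `a - b = 1_S w(t)`: the three terms are Lemarié-Rieusset's `R₁` split along
  `u₁ = u₃ + u₄` and the `w ⊗ w` part).

## Mathlib / tree

Tree: `pressureForm`, `pressureForm_symm`, `pressureForm_add_left`, `pressureForm_smul_left`,
`pressureForm_sum_left/right`, `pressureForm_eq_polarisation`, `coord`, `rieszTrunc`,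
`rieszTrunc_eq_setIntegral`, `integrable_mul_rieszTruncKernel`, `integrableOn_mul_rieszKernel_iff`,
`aestronglyMeasurable_rieszTrunc`, `exists_eLpNorm_rieszTrunc_le` (Thm. 3 (a)),
`ae_exists_tendsto_rieszTrunc` (Thm. 4 (a)), `integrableOn_pressureKernel_of_memLp`,
`HasPressurePV`, `normalisedPressure_eq` (used). Mathlib: `Lp.eLpNorm_lim_le_liminf_eLpNorm`,
`aestronglyMeasurable_of_tendsto_ae`, `eLpNorm_mono_real`.

## References

* E. M. Stein, *Singular integrals and differentiability properties of functions* (1970),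
  Ch. II §4.2 Thm. 3, §4.5 Thm. 4. [`Stein1971`]
* P. G. Lemarié-Rieusset, *The Navier–Stokes Problem in the 21st Century* (2016),
  doi:10.1201/b19556, Thm. 14.7, proof, file pp. 516–517 (the terms `R₁`, `R₂`).
  [`LemarieRieusset2016`]
-/

noncomputable section

open MeasureTheory Set Filter Topology Function Metric
open scoped ENNReal NNReal RealInnerProductSpace

namespace Literature.Analysis.FluidPDE

-- nested operator types in the imported pressure files
set_option maxSynthPendingDepth 3

/-! ## §1. Algebra of the bilinear form -/

section Algebra

/-- Additivity of `B_z` in the second slot. [folklore] -/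
theorem pressureForm_add_right (z a c c' : (EuclideanSpace ℝ (Fin 3))) :
    pressureForm z a (c + c') = pressureForm z a c + pressureForm z a c' := by
  rw [pressureForm_symm, pressureForm_add_left, pressureForm_symm z c a, pressureForm_symm z c' a]

/-- Homogeneity of `B_z` in the second slot. [folklore] -/
theorem pressureForm_smul_right (z a : (EuclideanSpace ℝ (Fin 3))) (r : ℝ) (c : (EuclideanSpace ℝ (Fin 3))) :
    pressureForm z a (r • c) = r * pressureForm z a c := by
  rw [pressureForm_symm, pressureForm_smul_left, pressureForm_symm]

/-- `B_z(a, c - c') = B_z(a, c) - B_z(a, c')`. [folklore] -/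
theorem pressureForm_sub_right (z a c c' : (EuclideanSpace ℝ (Fin 3))) :
    pressureForm z a (c - c') = pressureForm z a c - pressureForm z a c' := by
  rw [sub_eq_add_neg, pressureForm_add_right, ← neg_one_smul ℝ c', pressureForm_smul_right]
  ring

/-- **The difference of two quadratic kernels is bilinear in (difference, sum):**
`K(z)(a) - K(z)(b) = B_z(a - b, a + b)` (`a ⊗ a - b ⊗ b = (a-b) ⊗ a + b ⊗ (a-b)`, symmetry).
[folklore] -/
theorem pressureKernel_sub_eq_pressureForm (z a b : (EuclideanSpace ℝ (Fin 3))) :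
    pressureKernel z a - pressureKernel z b = pressureForm z (a - b) (a + b) := by
  simp only [pressureKernel_eq_pressureForm, pressureForm, inner_add_right, inner_sub_right,
    inner_sub_left, real_inner_comm a b]
  ring

/-- `|B_z(a, c)|` is controlled by the product of the norms (restated with the constant in
front). [folklore] -/
theorem abs_pressureForm_le' (z a c : (EuclideanSpace ℝ (Fin 3))) :
    |pressureForm z a c| ≤ ‖a‖ * ‖c‖ * (Real.pi * ‖z‖ ^ 3)⁻¹ := by
  rw [← div_eq_mul_inv]
  exact abs_pressureForm_le z a c

/-- **Expansion of the bilinear form along the orthonormal basis:**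
`B_z(f(y), g(y)) = Σᵢⱼ fᵢ(y) gⱼ(y) · ½(K(z)(bᵢ+bⱼ) - K(z)(bᵢ) - K(z)(bⱼ))`. [folklore] -/
theorem pressureForm_apply_eq_sum (z : (EuclideanSpace ℝ (Fin 3))) (f g : (EuclideanSpace ℝ (Fin 3)) → (EuclideanSpace ℝ (Fin 3))) (y : (EuclideanSpace ℝ (Fin 3))) :
    pressureForm z (f y) (g y) = ∑ i, ∑ j, coord f i y * coord g j y *
      (2⁻¹ * (pressureKernel z (stdOrthonormalBasis ℝ (EuclideanSpace ℝ (Fin 3)) i + stdOrthonormalBasis ℝ (EuclideanSpace ℝ (Fin 3)) j) -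
        pressureKernel z (stdOrthonormalBasis ℝ (EuclideanSpace ℝ (Fin 3)) i) - pressureKernel z (stdOrthonormalBasis ℝ (EuclideanSpace ℝ (Fin 3)) j))) := by
  set b := stdOrthonormalBasis ℝ (EuclideanSpace ℝ (Fin 3))
  have hf : f y = ∑ i, ⟪f y, b i⟫ • b i := by
    conv_lhs => rw [← b.sum_repr' (f y)]
    exact Finset.sum_congr rfl fun i _ => by rw [real_inner_comm]
  have hg : g y = ∑ j, ⟪g y, b j⟫ • b j := by
    conv_lhs => rw [← b.sum_repr' (g y)]
    exact Finset.sum_congr rfl fun j _ => by rw [real_inner_comm]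
  conv_lhs => rw [hf, hg]
  rw [pressureForm_sum_left]
  refine Finset.sum_congr rfl fun i _ => ?_
  rw [pressureForm_smul_left, pressureForm_sum_right, Finset.mul_sum]
  refine Finset.sum_congr rfl fun j _ => ?_
  rw [pressureForm_smul_right, pressureForm_eq_polarisation, coord, coord]
  ring

end Algebra

/-! ## §2. The truncated bilinear singular integrals -/

section Truncated

variable {p q : ℝ≥0∞} {f g : (EuclideanSpace ℝ (Fin 3)) → (EuclideanSpace ℝ (Fin 3))}

/-- The scalar densities `fᵢ gⱼ` are a.e.-strongly measurable. [folklore] -/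
theorem aestronglyMeasurable_coord_mul_coord (hf : AEStronglyMeasurable f volume)
    (hg : AEStronglyMeasurable g volume) (i j : Fin (Module.finrank ℝ (EuclideanSpace ℝ (Fin 3)))) :
    AEStronglyMeasurable (fun y => coord f i y * coord g j y) volume :=
  (hf.inner aestronglyMeasurable_const).mul (hg.inner aestronglyMeasurable_const)

/-- `|fᵢ gⱼ| ≤ |f||g|`. [folklore] -/
theorem abs_coord_mul_coord_le (f g : (EuclideanSpace ℝ (Fin 3)) → (EuclideanSpace ℝ (Fin 3))) (i j : Fin (Module.finrank ℝ (EuclideanSpace ℝ (Fin 3)))) (y : (EuclideanSpace ℝ (Fin 3))) :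
    |coord f i y * coord g j y| ≤ ‖f y‖ * ‖g y‖ := by
  set b := stdOrthonormalBasis ℝ (EuclideanSpace ℝ (Fin 3))
  have h1 : |⟪f y, b i⟫| ≤ ‖f y‖ := by
    simpa [b.orthonormal.1] using abs_real_inner_le_norm (f y) (b i)
  have h2 : |⟪g y, b j⟫| ≤ ‖g y‖ := by
    simpa [b.orthonormal.1] using abs_real_inner_le_norm (g y) (b j)
  rw [coord, coord, abs_mul]
  exact mul_le_mul h1 h2 (abs_nonneg _) (norm_nonneg _)

/-- `fᵢ gⱼ ∈ L^p` when `|f||g| ∈ L^p`. [folklore] -/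
theorem memLp_coord_mul_coord (hf : AEStronglyMeasurable f volume) (hg : AEStronglyMeasurable g volume)
    (hfg : MemLp (fun y => ‖f y‖ * ‖g y‖) p volume) (i j : Fin (Module.finrank ℝ (EuclideanSpace ℝ (Fin 3)))) :
    MemLp (fun y => coord f i y * coord g j y) p volume :=
  hfg.of_le (aestronglyMeasurable_coord_mul_coord hf hg i j) (Eventually.of_forall fun y => by
    rw [Real.norm_eq_abs, Real.norm_eq_abs, abs_of_nonneg (mul_nonneg (norm_nonneg _) (norm_nonneg _))]
    exact abs_coord_mul_coord_le f g i j y)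

/-- `‖fᵢ gⱼ‖_p ≤ ‖|f||g|‖_p`. [folklore] -/
theorem eLpNorm_coord_mul_coord_le (f g : (EuclideanSpace ℝ (Fin 3)) → (EuclideanSpace ℝ (Fin 3))) (i j : Fin (Module.finrank ℝ (EuclideanSpace ℝ (Fin 3)))) (p : ℝ≥0∞) :
    eLpNorm (fun y => coord f i y * coord g j y) p volume ≤ eLpNorm (fun y => ‖f y‖ * ‖g y‖) p volume :=
  eLpNorm_mono_real fun y => by
    rw [Real.norm_eq_abs]
    exact abs_coord_mul_coord_le f g i j y

/-- Integrability of `fᵢgⱼ(y) K(x-y)(a)` on the truncation region (Hölder). [folklore] -/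
theorem integrableOn_coord_mul_coord_mul_pressureKernel [hpq : ENNReal.HolderConjugate p q] (hq : 1 < q)
    (hq' : q ≠ ⊤) (hf : AEStronglyMeasurable f volume) (hg : AEStronglyMeasurable g volume)
    (hfg : MemLp (fun y => ‖f y‖ * ‖g y‖) p volume) (i j : Fin (Module.finrank ℝ (EuclideanSpace ℝ (Fin 3)))) (a x : (EuclideanSpace ℝ (Fin 3)))
    {ε : ℝ} (hε : 0 < ε) :
    IntegrableOn (fun y => coord f i y * coord g j y * pressureKernel (x - y) a) (closedBall x ε)ᶜ volume :=
  (integrableOn_mul_rieszKernel_iff a _ x ε).2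
    (integrable_mul_rieszTruncKernel hq hq' (memLp_coord_mul_coord hf hg hfg i j) hε a x)

/-- The truncated bilinear integrand as a sum of directional pieces (pointwise). [folklore] -/
theorem pressureForm_apply_eq_sum' (f g : (EuclideanSpace ℝ (Fin 3)) → (EuclideanSpace ℝ (Fin 3))) (x y : (EuclideanSpace ℝ (Fin 3))) :
    pressureForm (x - y) (f y) (g y) = ∑ i, ∑ j, 2⁻¹ * (coord f i y * coord g j y *
      pressureKernel (x - y) (stdOrthonormalBasis ℝ (EuclideanSpace ℝ (Fin 3)) i + stdOrthonormalBasis ℝ (EuclideanSpace ℝ (Fin 3)) j) -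
        coord f i y * coord g j y * pressureKernel (x - y) (stdOrthonormalBasis ℝ (EuclideanSpace ℝ (Fin 3)) i) -
        coord f i y * coord g j y * pressureKernel (x - y) (stdOrthonormalBasis ℝ (EuclideanSpace ℝ (Fin 3)) j)) := by
  rw [pressureForm_apply_eq_sum]
  refine Finset.sum_congr rfl fun i _ => Finset.sum_congr rfl fun j _ => ?_
  ring

/-- **Absolute convergence of the truncated bilinear singular integral** on `{|x-y| > ε}` for
measurable `f, g` with `|f||g| ∈ L^p`, `1 < p < ∞`. [cite: Stein1971, Ch. II §4.5 Thm 4] -/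
theorem integrableOn_pressureForm_of_memLp [hpq : ENNReal.HolderConjugate p q] (hq : 1 < q) (hq' : q ≠ ⊤)
    (hf : AEStronglyMeasurable f volume) (hg : AEStronglyMeasurable g volume)
    (hfg : MemLp (fun y => ‖f y‖ * ‖g y‖) p volume) (x : (EuclideanSpace ℝ (Fin 3))) {ε : ℝ} (hε : 0 < ε) :
    IntegrableOn (fun y => pressureForm (x - y) (f y) (g y)) (closedBall x ε)ᶜ volume := by
  set b := stdOrthonormalBasis ℝ (EuclideanSpace ℝ (Fin 3))
  have hfun : (fun y => pressureForm (x - y) (f y) (g y)) = fun y => ∑ i, ∑ j, 2⁻¹ *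
      (coord f i y * coord g j y * pressureKernel (x - y) (b i + b j) -
        coord f i y * coord g j y * pressureKernel (x - y) (b i) -
        coord f i y * coord g j y * pressureKernel (x - y) (b j)) :=
    funext fun y => pressureForm_apply_eq_sum' f g x y
  rw [hfun]
  refine integrable_finsetSum _ fun i _ => integrable_finsetSum _ fun j _ => ?_
  have h := fun a => integrableOn_coord_mul_coord_mul_pressureKernel hq hq' hf hg hfg i j a x hε
  exact (((h _).sub (h _)).sub (h _)).const_mul _

/-- **The truncated bilinear singular integral is a combination of the directional truncations:**
`∫_{|x-y|>ε} B_{x-y}(f(y), g(y)) dy = ½ Σᵢⱼ (T^{bᵢ+bⱼ}_ε - T^{bᵢ}_ε - T^{bⱼ}_ε)(fᵢgⱼ)(x)`. [folklore] -/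
theorem setIntegral_pressureForm_eq_sum_rieszTrunc [hpq : ENNReal.HolderConjugate p q] (hq : 1 < q)
    (hq' : q ≠ ⊤) (hf : AEStronglyMeasurable f volume) (hg : AEStronglyMeasurable g volume)
    (hfg : MemLp (fun y => ‖f y‖ * ‖g y‖) p volume) (x : (EuclideanSpace ℝ (Fin 3))) {ε : ℝ} (hε : 0 < ε) :
    ∫ y in (closedBall x ε)ᶜ, pressureForm (x - y) (f y) (g y) = ∑ i, ∑ j, 2⁻¹ *
      (rieszTrunc (stdOrthonormalBasis ℝ (EuclideanSpace ℝ (Fin 3)) i + stdOrthonormalBasis ℝ (EuclideanSpace ℝ (Fin 3)) j) ε (fun y => coord f i y * coord g j y) x -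
        rieszTrunc (stdOrthonormalBasis ℝ (EuclideanSpace ℝ (Fin 3)) i) ε (fun y => coord f i y * coord g j y) x -
        rieszTrunc (stdOrthonormalBasis ℝ (EuclideanSpace ℝ (Fin 3)) j) ε (fun y => coord f i y * coord g j y) x) := by
  set b := stdOrthonormalBasis ℝ (EuclideanSpace ℝ (Fin 3))
  have hI := fun i j a => integrableOn_coord_mul_coord_mul_pressureKernel hq hq' hf hg hfg i j a x hε
  have hterm : ∀ i j, IntegrableOn (fun y => 2⁻¹ * (coord f i y * coord g j y * pressureKernel (x - y) (b i + b j) -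
      coord f i y * coord g j y * pressureKernel (x - y) (b i) -
      coord f i y * coord g j y * pressureKernel (x - y) (b j))) (closedBall x ε)ᶜ :=
    fun i j => (((hI i j _).sub (hI i j _)).sub (hI i j _)).const_mul _
  have hij : ∀ i j, ∫ y in (closedBall x ε)ᶜ, 2⁻¹ * (coord f i y * coord g j y * pressureKernel (x - y) (b i + b j) -
      coord f i y * coord g j y * pressureKernel (x - y) (b i) -
      coord f i y * coord g j y * pressureKernel (x - y) (b j)) =
      2⁻¹ * (rieszTrunc (b i + b j) ε (fun y => coord f i y * coord g j y) x -
        rieszTrunc (b i) ε (fun y => coord f i y * coord g j y) x -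
        rieszTrunc (b j) ε (fun y => coord f i y * coord g j y) x) := by
    intro i j
    have h12 : IntegrableOn (fun y => coord f i y * coord g j y * pressureKernel (x - y) (b i + b j) -
        coord f i y * coord g j y * pressureKernel (x - y) (b i)) (closedBall x ε)ᶜ := (hI i j _).sub (hI i j _)
    rw [integral_const_mul, integral_sub h12 (hI i j _), integral_sub (hI i j _) (hI i j _),
      rieszTrunc_eq_setIntegral, rieszTrunc_eq_setIntegral, rieszTrunc_eq_setIntegral]
  calc ∫ y in (closedBall x ε)ᶜ, pressureForm (x - y) (f y) (g y)
      = ∫ y in (closedBall x ε)ᶜ, ∑ i, ∑ j, 2⁻¹ * (coord f i y * coord g j y * pressureKernel (x - y) (b i + b j) -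
          coord f i y * coord g j y * pressureKernel (x - y) (b i) -
          coord f i y * coord g j y * pressureKernel (x - y) (b j)) :=
        integral_congr_ae (Eventually.of_forall fun y => pressureForm_apply_eq_sum' f g x y)
    _ = ∑ i, ∫ y in (closedBall x ε)ᶜ, ∑ j, 2⁻¹ * (coord f i y * coord g j y * pressureKernel (x - y) (b i + b j) -
          coord f i y * coord g j y * pressureKernel (x - y) (b i) -
          coord f i y * coord g j y * pressureKernel (x - y) (b j)) :=
        integral_finsetSum _ fun i _ => integrable_finsetSum _ fun j _ => hterm i j
    _ = ∑ i, ∑ j, ∫ y in (closedBall x ε)ᶜ, 2⁻¹ * (coord f i y * coord g j y * pressureKernel (x - y) (b i + b j) -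
          coord f i y * coord g j y * pressureKernel (x - y) (b i) -
          coord f i y * coord g j y * pressureKernel (x - y) (b j)) :=
        Finset.sum_congr rfl fun i _ => integral_finsetSum _ fun j _ => hterm i j
    _ = _ := Finset.sum_congr rfl fun i _ => Finset.sum_congr rfl fun j _ => hij i j

/-- Measurability of the truncated bilinear singular integrals in `x`. [folklore] -/
theorem aestronglyMeasurable_setIntegral_pressureForm [hpq : ENNReal.HolderConjugate p q] (hq : 1 < q)
    (hq' : q ≠ ⊤) (hf : AEStronglyMeasurable f volume) (hg : AEStronglyMeasurable g volume)
    (hfg : MemLp (fun y => ‖f y‖ * ‖g y‖) p volume) {ε : ℝ} (hε : 0 < ε) :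
    AEStronglyMeasurable (fun x => ∫ y in (closedBall x ε)ᶜ, pressureForm (x - y) (f y) (g y)) volume := by
  have hfun : (fun x => ∫ y in (closedBall x ε)ᶜ, pressureForm (x - y) (f y) (g y)) = fun x => ∑ i, ∑ j, 2⁻¹ *
      (rieszTrunc (stdOrthonormalBasis ℝ (EuclideanSpace ℝ (Fin 3)) i + stdOrthonormalBasis ℝ (EuclideanSpace ℝ (Fin 3)) j) ε (fun y => coord f i y * coord g j y) x -
        rieszTrunc (stdOrthonormalBasis ℝ (EuclideanSpace ℝ (Fin 3)) i) ε (fun y => coord f i y * coord g j y) x -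
        rieszTrunc (stdOrthonormalBasis ℝ (EuclideanSpace ℝ (Fin 3)) j) ε (fun y => coord f i y * coord g j y) x) :=
    funext fun x => setIntegral_pressureForm_eq_sum_rieszTrunc hq hq' hf hg hfg x hε
  rw [hfun]
  refine Finset.aestronglyMeasurable_fun_sum _ fun i _ => Finset.aestronglyMeasurable_fun_sum _ fun j _ => ?_
  have hm := fun a => aestronglyMeasurable_rieszTrunc (aestronglyMeasurable_coord_mul_coord hf hg i j) a ε
  exact (((hm _).sub (hm _)).sub (hm _)).const_mul _

/-- **`L^p` bound for the truncated bilinear singular integrals** (Theorem 3 (a) on `L^p` for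
each directional piece, `‖fᵢgⱼ‖_p ≤ ‖|f||g|‖_p`):
`‖∫_{|·-y|>ε} B_{·-y}(f(y), g(y)) dy‖_p ≤ (27/2) A ‖|f||g|‖_p`. [cite: Stein1971, Ch. II §4.2 Thm 3 (a)] -/
theorem eLpNorm_setIntegral_pressureForm_le [hpq : ENNReal.HolderConjugate p q] (hq : 1 < q) (hq' : q ≠ ⊤)
    (hp1 : 1 ≤ p) {A : ℝ≥0∞}
    (hA : ∀ ε : ℝ, 0 < ε → ∀ a : (EuclideanSpace ℝ (Fin 3)), ‖a‖ ≤ 2 → ∀ h : (EuclideanSpace ℝ (Fin 3)) → ℝ, MemLp h p volume →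
      eLpNorm (rieszTrunc a ε h) p volume ≤ A * eLpNorm h p volume)
    (hf : AEStronglyMeasurable f volume) (hg : AEStronglyMeasurable g volume)
    (hfg : MemLp (fun y => ‖f y‖ * ‖g y‖) p volume) {ε : ℝ} (hε : 0 < ε) :
    eLpNorm (fun x => ∫ y in (closedBall x ε)ᶜ, pressureForm (x - y) (f y) (g y)) p volume ≤
      27 * 2⁻¹ * A * eLpNorm (fun y => ‖f y‖ * ‖g y‖) p volume := by
  set b := stdOrthonormalBasis ℝ (EuclideanSpace ℝ (Fin 3))
  set N : ℝ≥0∞ := eLpNorm (fun y => ‖f y‖ * ‖g y‖) p volume with hN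
  set F : Fin (Module.finrank ℝ (EuclideanSpace ℝ (Fin 3))) → Fin (Module.finrank ℝ (EuclideanSpace ℝ (Fin 3))) → (EuclideanSpace ℝ (Fin 3)) → ℝ :=
    fun i j y => coord f i y * coord g j y with hF
  have hfun : (fun x => ∫ y in (closedBall x ε)ᶜ, pressureForm (x - y) (f y) (g y)) = (2⁻¹ : ℝ) • fun x => ∑ i, ∑ j,
      (rieszTrunc (b i + b j) ε (F i j) x - rieszTrunc (b i) ε (F i j) x - rieszTrunc (b j) ε (F i j) x) := by
    funext x
    rw [setIntegral_pressureForm_eq_sum_rieszTrunc hq hq' hf hg hfg x hε]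
    simp only [Pi.smul_apply, smul_eq_mul, Finset.mul_sum]
    rfl
  have hcp : ∀ i j, MemLp (F i j) p volume := memLp_coord_mul_coord hf hg hfg
  have hH : ∀ (i j) (u : (EuclideanSpace ℝ (Fin 3))), ‖u‖ ≤ 2 → eLpNorm (rieszTrunc u ε (F i j)) p volume ≤ A * N :=
    fun i j u hu => (hA ε hε u hu _ (hcp i j)).trans (mul_le_mul' le_rfl (eLpNorm_coord_mul_coord_le f g i j p))
  have hm : ∀ (i j) (u : (EuclideanSpace ℝ (Fin 3))), AEStronglyMeasurable (rieszTrunc u ε (F i j)) volume :=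
    fun i j u => aestronglyMeasurable_rieszTrunc (aestronglyMeasurable_coord_mul_coord hf hg i j) u ε
  have hterm : ∀ i j, eLpNorm (fun x => rieszTrunc (b i + b j) ε (F i j) x -
      rieszTrunc (b i) ε (F i j) x - rieszTrunc (b j) ε (F i j) x) p volume ≤ 3 * (A * N) := by
    intro i j
    calc eLpNorm (fun x => rieszTrunc (b i + b j) ε (F i j) x -
          rieszTrunc (b i) ε (F i j) x - rieszTrunc (b j) ε (F i j) x) p volume
        ≤ eLpNorm (fun x => rieszTrunc (b i + b j) ε (F i j) x -
            rieszTrunc (b i) ε (F i j) x) p volume + eLpNorm (rieszTrunc (b j) ε (F i j)) p volume :=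
          eLpNorm_sub_le ((hm i j _).sub (hm i j _)) (hm i j _) hp1
      _ ≤ (eLpNorm (rieszTrunc (b i + b j) ε (F i j)) p volume +
            eLpNorm (rieszTrunc (b i) ε (F i j)) p volume) +
            eLpNorm (rieszTrunc (b j) ε (F i j)) p volume := by
          gcongr
          exact eLpNorm_sub_le (hm i j _) (hm i j _) hp1
      _ ≤ (A * N + A * N) + A * N := by
          gcongr
          · exact hH i j _ (norm_stdOrthonormalBasis_add_le i j)
          · exact hH i j _ (norm_stdOrthonormalBasis_le i)
          · exact hH i j _ (norm_stdOrthonormalBasis_le j)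
      _ = 3 * (A * N) := by ring
  rw [hfun, eLpNorm_const_smul]
  have hsum : eLpNorm (fun x => ∑ i, ∑ j, (rieszTrunc (b i + b j) ε (F i j) x -
      rieszTrunc (b i) ε (F i j) x - rieszTrunc (b j) ε (F i j) x)) p volume ≤
      (9 : ℕ) • (3 * (A * N)) := by
    have hfun2 : (fun x => ∑ i, ∑ j, (rieszTrunc (b i + b j) ε (F i j) x -
        rieszTrunc (b i) ε (F i j) x - rieszTrunc (b j) ε (F i j) x)) =
        ∑ i, ∑ j, fun x => (rieszTrunc (b i + b j) ε (F i j) x -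
          rieszTrunc (b i) ε (F i j) x - rieszTrunc (b j) ε (F i j) x) := by
      funext x
      simp only [Finset.sum_apply]
    rw [hfun2]
    calc eLpNorm (∑ i, ∑ j, fun x => (rieszTrunc (b i + b j) ε (F i j) x -
          rieszTrunc (b i) ε (F i j) x - rieszTrunc (b j) ε (F i j) x)) p volume
        ≤ ∑ i, eLpNorm (∑ j, fun x => (rieszTrunc (b i + b j) ε (F i j) x -
            rieszTrunc (b i) ε (F i j) x - rieszTrunc (b j) ε (F i j) x)) p volume :=
          eLpNorm_sum_le (fun i _ => Finset.aestronglyMeasurable_sum _ fun j _ =>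
            ((hm i j _).sub (hm i j _)).sub (hm i j _)) hp1
      _ ≤ ∑ i, ∑ j, eLpNorm (fun x => (rieszTrunc (b i + b j) ε (F i j) x -
            rieszTrunc (b i) ε (F i j) x - rieszTrunc (b j) ε (F i j) x)) p volume :=
          Finset.sum_le_sum fun i _ => eLpNorm_sum_le (fun j _ => ((hm i j _).sub (hm i j _)).sub (hm i j _)) hp1
      _ ≤ ∑ _i : Fin (Module.finrank ℝ (EuclideanSpace ℝ (Fin 3))), ∑ _j : Fin (Module.finrank ℝ (EuclideanSpace ℝ (Fin 3))), 3 * (A * N) :=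
          Finset.sum_le_sum fun i _ => Finset.sum_le_sum fun j _ => hterm i j
      _ = (9 : ℕ) • (3 * (A * N)) := by
          rw [Finset.sum_const, Finset.sum_const, Finset.card_univ, Fintype.card_fin,
            finrank_euclideanSpace_fin, smul_smul]
          norm_num
  have h2 : ‖(2⁻¹ : ℝ)‖ₑ = 2⁻¹ := by
    rw [Real.enorm_eq_ofReal (by norm_num), ENNReal.ofReal_inv_of_pos (by norm_num), ENNReal.ofReal_ofNat]
  rw [h2]
  calc (2⁻¹ : ℝ≥0∞) * eLpNorm (fun x => ∑ i, ∑ j, (rieszTrunc (b i + b j) ε (F i j) x -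
        rieszTrunc (b i) ε (F i j) x - rieszTrunc (b j) ε (F i j) x)) p volume
      ≤ 2⁻¹ * ((9 : ℕ) • (3 * (A * N))) := mul_le_mul' le_rfl hsum
    _ = 27 * 2⁻¹ * A * N := by
        rw [nsmul_eq_mul]
        push_cast
        ring

/-- **The limit `ε → 0⁺` of the truncated bilinear singular integrals exists for a.e. `x`**
when `f, g` are measurable with `|f||g| ∈ L^p`, `1 < p < ∞` (Theorem 4 (a) for each of the 27
directional truncations of the expansion). [cite: Stein1971, Ch. II §4.5 Thm 4 (a)] -/
theorem ae_exists_tendsto_setIntegral_pressureForm (hp1 : 1 < p) (hp2 : p < ⊤)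
    (hf : AEStronglyMeasurable f volume) (hg : AEStronglyMeasurable g volume)
    (hfg : MemLp (fun y => ‖f y‖ * ‖g y‖) p volume) :
    ∀ᵐ x : (EuclideanSpace ℝ (Fin 3)), ∃ L : ℝ,
      Tendsto (fun ε => ∫ y in (closedBall x ε)ᶜ, pressureForm (x - y) (f y) (g y)) (𝓝[>] 0) (𝓝 L) := by
  set b := stdOrthonormalBasis ℝ (EuclideanSpace ℝ (Fin 3))
  set F : Fin (Module.finrank ℝ (EuclideanSpace ℝ (Fin 3))) → Fin (Module.finrank ℝ (EuclideanSpace ℝ (Fin 3))) → (EuclideanSpace ℝ (Fin 3)) → ℝ :=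
    fun i j y => coord f i y * coord g j y with hF
  -- conjugate exponent
  set q : ℝ≥0∞ := ENNReal.conjExponent p with hq
  haveI hpq : ENNReal.HolderConjugate p q := ENNReal.HolderConjugate.conjExponent hp1.le
  have hq1 : 1 < q := (ENNReal.HolderConjugate.lt_top_iff_one_lt p q).1 hp2
  have hqt : q ≠ ⊤ := (ENNReal.HolderConjugate.ne_top_iff_ne_one q p).2 (ne_of_gt hp1)
  have hcp : ∀ i j, MemLp (F i j) p volume := memLp_coord_mul_coord hf hg hfg
  have hae : ∀ᵐ x : (EuclideanSpace ℝ (Fin 3)), ∀ ij : Fin (Module.finrank ℝ (EuclideanSpace ℝ (Fin 3))) × Fin (Module.finrank ℝ (EuclideanSpace ℝ (Fin 3))),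
      (∃ L₁ : ℝ, Tendsto (fun ε => rieszTrunc (b ij.1 + b ij.2) ε (F ij.1 ij.2) x) (𝓝[>] 0) (𝓝 L₁)) ∧
      (∃ L₂ : ℝ, Tendsto (fun ε => rieszTrunc (b ij.1) ε (F ij.1 ij.2) x) (𝓝[>] 0) (𝓝 L₂)) ∧
      (∃ L₃ : ℝ, Tendsto (fun ε => rieszTrunc (b ij.2) ε (F ij.1 ij.2) x) (𝓝[>] 0) (𝓝 L₃)) := by
    rw [ae_all_iff]
    intro ij
    exact ((ae_exists_tendsto_rieszTrunc hp1 hp2 (norm_stdOrthonormalBasis_add_le ij.1 ij.2) (hcp ij.1 ij.2)).and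
      ((ae_exists_tendsto_rieszTrunc hp1 hp2 (norm_stdOrthonormalBasis_le ij.1) (hcp ij.1 ij.2)).and
        (ae_exists_tendsto_rieszTrunc hp1 hp2 (norm_stdOrthonormalBasis_le ij.2) (hcp ij.1 ij.2))))
  filter_upwards [hae] with x hx
  choose L₁ hL₁ using fun ij => (hx ij).1
  choose L₂ hL₂ using fun ij => (hx ij).2.1
  choose L₃ hL₃ using fun ij => (hx ij).2.2
  refine ⟨∑ i, ∑ j, 2⁻¹ * (L₁ (i, j) - L₂ (i, j) - L₃ (i, j)), ?_⟩
  have hlim : Tendsto (fun ε => ∑ i, ∑ j, 2⁻¹ *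
      (rieszTrunc (b i + b j) ε (F i j) x - rieszTrunc (b i) ε (F i j) x - rieszTrunc (b j) ε (F i j) x)) (𝓝[>] 0)
      (𝓝 (∑ i, ∑ j, 2⁻¹ * (L₁ (i, j) - L₂ (i, j) - L₃ (i, j)))) :=
    tendsto_finsetSum _ fun i _ => tendsto_finsetSum _ fun j _ =>
      (((hL₁ (i, j)).sub (hL₂ (i, j))).sub (hL₃ (i, j))).const_mul _
  refine hlim.congr' ?_
  filter_upwards [self_mem_nhdsWithin] with ε hε
  exact (setIntegral_pressureForm_eq_sum_rieszTrunc hq1 hqt hf hg hfg x hε).symm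

/-- **The bilinear principal value with its `L^p` bound.** For `1 < p < ∞` and measurable
`f, g` with `|f||g| ∈ L^p` there is a measurable `P` (the a.e. limit of the truncated bilinear
singular integrals, `P = limUnder`) with
`∫_{|x-y|>ε} B_{x-y}(f(y), g(y)) dy → P(x)` as `ε → 0⁺` for a.e. `x` and
`‖P‖_p ≤ (27/2) A_p ‖|f||g|‖_p`, `A_p` the constant of Theorem 3 (a) on `L^p` (Fatou along
`ε = 1/(n+1)`). [cite: Stein1971, Ch. II §4.2 Thm 3 (b) and §4.5 Thm 4 (a)] -/
theorem exists_bilinear_pv (hp1 : 1 < p) (hp2 : p < ⊤) {A : ℝ≥0∞}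
    (hA : ∀ ε : ℝ, 0 < ε → ∀ a : (EuclideanSpace ℝ (Fin 3)), ‖a‖ ≤ 2 → ∀ h : (EuclideanSpace ℝ (Fin 3)) → ℝ, MemLp h p volume →
      eLpNorm (rieszTrunc a ε h) p volume ≤ A * eLpNorm h p volume)
    (hf : AEStronglyMeasurable f volume) (hg : AEStronglyMeasurable g volume)
    (hfg : MemLp (fun y => ‖f y‖ * ‖g y‖) p volume) :
    ∃ P : (EuclideanSpace ℝ (Fin 3)) → ℝ, AEStronglyMeasurable P volume ∧
      (∀ᵐ x : (EuclideanSpace ℝ (Fin 3)), Tendsto (fun ε => ∫ y in (closedBall x ε)ᶜ, pressureForm (x - y) (f y) (g y))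
        (𝓝[>] 0) (𝓝 (P x))) ∧
      eLpNorm P p volume ≤ 27 * 2⁻¹ * A * eLpNorm (fun y => ‖f y‖ * ‖g y‖) p volume := by
  -- conjugate exponent
  set q : ℝ≥0∞ := ENNReal.conjExponent p with hq
  haveI hpq : ENNReal.HolderConjugate p q := ENNReal.HolderConjugate.conjExponent hp1.le
  have hq1 : 1 < q := (ENNReal.HolderConjugate.lt_top_iff_one_lt p q).1 hp2
  have hqt : q ≠ ⊤ := (ENNReal.HolderConjugate.ne_top_iff_ne_one q p).2 (ne_of_gt hp1)
  set T : (EuclideanSpace ℝ (Fin 3)) → ℝ → ℝ := fun x ε => ∫ y in (closedBall x ε)ᶜ, pressureForm (x - y) (f y) (g y) with hT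
  set P : (EuclideanSpace ℝ (Fin 3)) → ℝ := fun x => limUnder (𝓝[>] (0 : ℝ)) (T x) with hP
  set Tn : ℕ → (EuclideanSpace ℝ (Fin 3)) → ℝ := fun n x => T x (1 / ((n : ℝ) + 1)) with hTn
  have hseq : Tendsto (fun n : ℕ => 1 / ((n : ℝ) + 1)) atTop (𝓝[>] 0) := by
    rw [tendsto_nhdsWithin_iff]
    exact ⟨tendsto_one_div_add_atTop_nhds_zero_nat,
      Eventually.of_forall fun n => mem_Ioi.2 (one_div_pos.2 (Nat.cast_add_one_pos n))⟩
  have hPV := ae_exists_tendsto_setIntegral_pressureForm hp1 hp2 hf hg hfg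
  have hlimP : ∀ᵐ x, Tendsto (T x) (𝓝[>] 0) (𝓝 (P x)) := by
    filter_upwards [hPV] with x hx
    obtain ⟨L', hL'⟩ := hx
    rw [hP]
    simp only
    rw [hL'.limUnder_eq]
    exact hL'
  have hTlim : ∀ᵐ x, Tendsto (fun n => Tn n x) atTop (𝓝 (P x)) := by
    filter_upwards [hlimP] with x hx
    exact hx.comp hseq
  have hTm : ∀ n, AEStronglyMeasurable (Tn n) volume := fun n =>
    aestronglyMeasurable_setIntegral_pressureForm hq1 hqt hf hg hfg (one_div_pos.2 (Nat.cast_add_one_pos n))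
  have hPm : AEStronglyMeasurable P volume := aestronglyMeasurable_of_tendsto_ae atTop hTm hTlim
  refine ⟨P, hPm, hlimP, ?_⟩
  have hF := Lp.eLpNorm_lim_le_liminf_eLpNorm (p := p) hTm P hTlim
  refine hF.trans (liminf_le_of_frequently_le' (Eventually.of_forall fun n => ?_).frequently)
  exact eLpNorm_setIntegral_pressureForm_le hq1 hqt hp1.le hA hf hg hfg (one_div_pos.2 (Nat.cast_add_one_pos n))

end Truncated

/-! ## §3. The difference of two normalised pressures -/

section Difference

variable {a b : (EuclideanSpace ℝ (Fin 3)) → (EuclideanSpace ℝ (Fin 3))}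

/-- **The truncated integrals of `K(a) - K(b)` are the truncated bilinear integrals of
`B(a - b, a + b)`** (when both truncated quadratic integrands are integrable). [folklore] -/
theorem truncatedPressureIntegral_sub_eq {x : (EuclideanSpace ℝ (Fin 3))} {ε : ℝ}
    (ha : IntegrableOn (fun y => pressureKernel (x - y) (a y)) (closedBall x ε)ᶜ volume)
    (hb : IntegrableOn (fun y => pressureKernel (x - y) (b y)) (closedBall x ε)ᶜ volume) :
    truncatedPressureIntegral a x ε - truncatedPressureIntegral b x ε =
      ∫ y in (closedBall x ε)ᶜ, pressureForm (x - y) ((a - b) y) ((a + b) y) := by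
  rw [truncatedPressureIntegral, truncatedPressureIntegral, ← integral_sub ha hb]
  refine integral_congr_ae (Eventually.of_forall fun y => ?_)
  simp only [Pi.sub_apply, Pi.add_apply]
  exact pressureKernel_sub_eq_pressureForm _ _ _

/-- **The difference of two normalised pressures at a point where both principal values
exist:** `p̃[a](x) - p̃[b](x) = -(|a(x)|² - |b(x)|²)/3 + (L_a - L_b)`. [folklore] -/
theorem normalisedPressure_sub_eq {x : (EuclideanSpace ℝ (Fin 3))} {La Lb : ℝ} (ha : HasPressurePV a x La)
    (hb : HasPressurePV b x Lb) :
    normalisedPressure a x - normalisedPressure b x = -(‖a x‖ ^ 2 - ‖b x‖ ^ 2) / 3 + (La - Lb) := by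
  rw [normalisedPressure_eq ha, normalisedPressure_eq hb, finrank_euclideanSpace_fin]
  push_cast
  ring

/-- `|a|² - |b|² = ⟨a - b, a + b⟩`. [folklore] -/
theorem norm_sq_sub_norm_sq_eq_inner (u v : (EuclideanSpace ℝ (Fin 3))) : ‖u‖ ^ 2 - ‖v‖ ^ 2 = ⟪u - v, u + v⟫ := by
  rw [inner_add_right, inner_sub_left, inner_sub_left, real_inner_self_eq_norm_sq,
    real_inner_self_eq_norm_sq, real_inner_comm u v]
  ring

/-- The `L^p` norm of a pointwise inner product is at most that of the product of the norms.
[folklore] -/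
theorem eLpNorm_inner_le (f g : (EuclideanSpace ℝ (Fin 3)) → (EuclideanSpace ℝ (Fin 3))) (p : ℝ≥0∞) :
    eLpNorm (fun y => ⟪f y, g y⟫) p volume ≤ eLpNorm (fun y => ‖f y‖ * ‖g y‖) p volume :=
  eLpNorm_mono_real fun y => by
    rw [Real.norm_eq_abs]
    exact abs_real_inner_le_norm _ _

/-- `‖|c|²‖_p = ‖|c||c|‖_p` (the same function). [folklore] -/
theorem eLpNorm_norm_sq_eq_eLpNorm_norm_mul_norm (c : (EuclideanSpace ℝ (Fin 3)) → (EuclideanSpace ℝ (Fin 3))) (p : ℝ≥0∞) :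
    eLpNorm (fun y => ‖c y‖ ^ 2) p volume = eLpNorm (fun y => ‖c y‖ * ‖c y‖) p volume := by
  congr 1
  funext y
  ring

/-- **The difference of two Riesz-transform pressures, decomposed for the weak–strong
argument.** There is an absolute constant `C` such that: for measurable fields `a, b, e` on `(EuclideanSpace ℝ (Fin 3))`
with `|a|², |b|² ∈ L^{3/2}` (so that the principal values defining `p̃[a]`, `p̃[b]` exist a.e.),
`|a - b||e| ∈ L²` and `|a - b||a - e| ∈ L²`, there are measurable `Q₁, Q₂, Q₃` with

  `p̃[a] - p̃[b] = Q₁ + Q₂ + Q₃` a.e.,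
  `‖Q₁‖₂ ≤ C ‖|a - b||e|‖₂`, `‖Q₂‖₂ ≤ C ‖|a - b||a - e|‖₂`, `‖Q₃‖_{3/2} ≤ C ‖|a - b|²‖_{3/2}`.

(`p̃[a] - p̃[b] = -⟨c, a+b⟩/3 + p.v.∫ B(c, a+b)`, `c = a - b`, and `a + b = 2e + 2(a-e) - c`
in the second slot: `Q₁ = -⅔⟨c,e⟩ + 2 p.v.∫B(c,e)`, `Q₂ = -⅔⟨c,a-e⟩ + 2 p.v.∫B(c,a-e)`,
`Q₃ = ⅓|c|² - p.v.∫B(c,c)`, each bounded by the bilinear Calderón–Zygmund inequality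
`exists_bilinear_pv`; `C = ⅔ + 27(A₂ + A_{3/2})`.) In the weak–strong argument
(Lemarié-Rieusset 2016, proof of Thm. 14.7, p. 517, the terms `R₁`, `R₂`) `a = 1_S u₁(t)`,
`b = 1_S u₂(t)`, `e = 1_S u₃(t)`, so `a - e = 1_S u₄(t)` and `a - b = 1_S w(t)`.
[cite: Stein1971, Ch. II §4.2 Thm 3 and §4.5 Thm 4 (the Calderón–Zygmund inequality used); LemarieRieusset2016, Thm. 14.7, proof (file pp. 516–517)] -/
theorem exists_normalisedPressure_sub_eq_add₃ :
    ∃ C : ℝ≥0, ∀ (a b e : (EuclideanSpace ℝ (Fin 3)) → (EuclideanSpace ℝ (Fin 3))), AEStronglyMeasurable a volume → AEStronglyMeasurable b volume →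
      AEStronglyMeasurable e volume →
      MemLp (fun y => ‖a y‖ ^ 2) (3 / 2 : ℝ≥0∞) volume → MemLp (fun y => ‖b y‖ ^ 2) (3 / 2 : ℝ≥0∞) volume →
      MemLp (fun y => ‖a y - b y‖ * ‖e y‖) 2 volume →
      MemLp (fun y => ‖a y - b y‖ * ‖a y - e y‖) 2 volume →
      ∃ Q₁ Q₂ Q₃ : (EuclideanSpace ℝ (Fin 3)) → ℝ, AEStronglyMeasurable Q₁ volume ∧ AEStronglyMeasurable Q₂ volume ∧
        AEStronglyMeasurable Q₃ volume ∧
        ((fun x => normalisedPressure a x - normalisedPressure b x) =ᵐ[volume]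
          fun x => Q₁ x + Q₂ x + Q₃ x) ∧
        eLpNorm Q₁ 2 volume ≤ C * eLpNorm (fun y => ‖a y - b y‖ * ‖e y‖) 2 volume ∧
        eLpNorm Q₂ 2 volume ≤ C * eLpNorm (fun y => ‖a y - b y‖ * ‖a y - e y‖) 2 volume ∧
        eLpNorm Q₃ (3 / 2 : ℝ≥0∞) volume ≤ C * eLpNorm (fun y => ‖a y - b y‖ ^ 2) (3 / 2 : ℝ≥0∞) volume := by
  -- the two Calderón–Zygmund constants
  have h2_1 : (1 : ℝ≥0∞) < 2 := by norm_num
  have h2_t : (2 : ℝ≥0∞) < ⊤ := ENNReal.ofNat_lt_top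
  have h32_1 : (1 : ℝ≥0∞) < 3 / 2 := by
    rw [ENNReal.lt_div_iff_mul_lt (Or.inl two_ne_zero) (Or.inl ENNReal.ofNat_ne_top)]
    norm_num
  have h32_t : (3 / 2 : ℝ≥0∞) < ⊤ := ENNReal.div_lt_top ENNReal.ofNat_ne_top two_ne_zero
  obtain ⟨A₂, hA₂t, hA₂⟩ := exists_eLpNorm_rieszTrunc_le (p := (2 : ℝ≥0∞)) h2_1 h2_t
  obtain ⟨A₃, hA₃t, hA₃⟩ := exists_eLpNorm_rieszTrunc_le (p := (3 / 2 : ℝ≥0∞)) h32_1 h32_t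
  set K₂ : ℝ≥0∞ := 27 * 2⁻¹ * A₂ with hK₂
  set K₃ : ℝ≥0∞ := 27 * 2⁻¹ * A₃ with hK₃
  have hK₂t : K₂ ≠ ⊤ := by simp only [hK₂]; finiteness
  have hK₃t : K₃ ≠ ⊤ := by simp only [hK₃]; finiteness
  set C : ℝ≥0∞ := 2 * 3⁻¹ + 2 * K₂ + (3⁻¹ + K₃) with hC
  have hCt : C ≠ ⊤ := by simp only [hC]; finiteness
  refine ⟨C.toNNReal, fun a b e ha hb he ha2 hb2 hce hcd => ?_⟩
  have hCe : ((C.toNNReal : ℝ≥0) : ℝ≥0∞) = C := ENNReal.coe_toNNReal hCt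
  rw [hCe]
  -- abbreviations
  set c : (EuclideanSpace ℝ (Fin 3)) → (EuclideanSpace ℝ (Fin 3)) := fun y => a y - b y with hc
  set d : (EuclideanSpace ℝ (Fin 3)) → (EuclideanSpace ℝ (Fin 3)) := fun y => a y - e y with hd
  have hcm : AEStronglyMeasurable c volume := ha.sub hb
  have hdm : AEStronglyMeasurable d volume := ha.sub he
  -- `|c|² ∈ L^{3/2}` as the product `|c||c|`
  have hcc : MemLp (fun y => ‖c y‖ * ‖c y‖) (3 / 2 : ℝ≥0∞) volume := by
    have hsum : MemLp (fun y => 2 * ‖a y‖ ^ 2 + 2 * ‖b y‖ ^ 2) (3 / 2 : ℝ≥0∞) volume :=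
      (ha2.const_mul 2).add (hb2.const_mul 2)
    refine hsum.of_le (hcm.norm.mul hcm.norm) (Eventually.of_forall fun y => ?_)
    rw [Real.norm_eq_abs, Real.norm_eq_abs, abs_of_nonneg (by positivity), abs_of_nonneg (by positivity)]
    have h := norm_sub_le (a y) (b y)
    have h' : ‖c y‖ * ‖c y‖ ≤ (‖a y‖ + ‖b y‖) * (‖a y‖ + ‖b y‖) :=
      mul_le_mul h h (norm_nonneg _) (by positivity)
    nlinarith [sq_nonneg (‖a y‖ - ‖b y‖)]
  -- the three bilinear principal values
  obtain ⟨P₁, hP₁m, hP₁, hP₁b⟩ := exists_bilinear_pv (f := c) (g := e) h2_1 h2_t hA₂ hcm he hce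
  obtain ⟨P₂, hP₂m, hP₂, hP₂b⟩ := exists_bilinear_pv (f := c) (g := d) h2_1 h2_t hA₂ hcm hdm hcd
  obtain ⟨P₃, hP₃m, hP₃, hP₃b⟩ := exists_bilinear_pv (f := c) (g := c) h32_1 h32_t hA₃ hcm hcm hcc
  -- the principal values of `a` and `b` exist a.e.
  have hPVa := ae_exists_hasPressurePV h32_1 h32_t ha ha2
  have hPVb := ae_exists_hasPressurePV h32_1 h32_t hb hb2
  -- the three pieces
  set Q₁ : (EuclideanSpace ℝ (Fin 3)) → ℝ := fun x => -(2 * 3⁻¹) * ⟪c x, e x⟫ + 2 * P₁ x with hQ₁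
  set Q₂ : (EuclideanSpace ℝ (Fin 3)) → ℝ := fun x => -(2 * 3⁻¹) * ⟪c x, d x⟫ + 2 * P₂ x with hQ₂
  set Q₃ : (EuclideanSpace ℝ (Fin 3)) → ℝ := fun x => 3⁻¹ * ⟪c x, c x⟫ - P₃ x with hQ₃
  have hQ₁m : AEStronglyMeasurable Q₁ volume :=
    ((hcm.inner he).const_mul _).add (hP₁m.const_mul _)
  have hQ₂m : AEStronglyMeasurable Q₂ volume :=
    ((hcm.inner hdm).const_mul _).add (hP₂m.const_mul _)
  have hQ₃m : AEStronglyMeasurable Q₃ volume :=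
    ((hcm.inner hcm).const_mul _).sub hP₃m
  refine ⟨Q₁, Q₂, Q₃, hQ₁m, hQ₂m, hQ₃m, ?_, ?_, ?_, ?_⟩
  · -- ## the identity a.e.
    -- conjugate exponents for the integrability of the truncations
    haveI hpq2 : ENNReal.HolderConjugate (2 : ℝ≥0∞) 2 := ENNReal.HolderConjugate.instTwoTwo
    set q₃ : ℝ≥0∞ := ENNReal.conjExponent (3 / 2 : ℝ≥0∞) with hq₃
    haveI hpq3 : ENNReal.HolderConjugate (3 / 2 : ℝ≥0∞) q₃ := ENNReal.HolderConjugate.conjExponent h32_1.le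
    have hq3_1 : 1 < q₃ := (ENNReal.HolderConjugate.lt_top_iff_one_lt (3 / 2 : ℝ≥0∞) q₃).1 h32_t
    have hq3_t : q₃ ≠ ⊤ := (ENNReal.HolderConjugate.ne_top_iff_ne_one q₃ (3 / 2 : ℝ≥0∞)).2 (ne_of_gt h32_1)
    filter_upwards [hPVa, hPVb, hP₁, hP₂, hP₃] with x hxa hxb hx₁ hx₂ hx₃
    obtain ⟨La, hLa⟩ := hxa
    obtain ⟨Lb, hLb⟩ := hxb
    -- the truncations of the difference, for `ε > 0`
    have htrunc : ∀ ε : ℝ, 0 < ε → truncatedPressureIntegral a x ε - truncatedPressureIntegral b x ε =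
        2 * (∫ y in (closedBall x ε)ᶜ, pressureForm (x - y) (c y) (e y)) +
          2 * (∫ y in (closedBall x ε)ᶜ, pressureForm (x - y) (c y) (d y)) -
          ∫ y in (closedBall x ε)ᶜ, pressureForm (x - y) (c y) (c y) := by
      intro ε hε
      have hIa := integrableOn_pressureKernel_of_memLp hq3_1 hq3_t ha ha2 x hε
      have hIb := integrableOn_pressureKernel_of_memLp hq3_1 hq3_t hb hb2 x hε
      have hI₁ := integrableOn_pressureForm_of_memLp (by norm_num : (1 : ℝ≥0∞) < 2) ENNReal.ofNat_ne_top hcm he hce x hε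
      have hI₂ := integrableOn_pressureForm_of_memLp (by norm_num : (1 : ℝ≥0∞) < 2) ENNReal.ofNat_ne_top hcm hdm hcd x hε
      have hI₃ := integrableOn_pressureForm_of_memLp hq3_1 hq3_t hcm hcm hcc x hε
      rw [truncatedPressureIntegral_sub_eq hIa hIb]
      have hpt : ∀ y, pressureForm (x - y) ((a - b) y) ((a + b) y) =
          2 * pressureForm (x - y) (c y) (e y) + 2 * pressureForm (x - y) (c y) (d y) -
            pressureForm (x - y) (c y) (c y) := by
        intro y
        have hsum : (a + b) y = (2 : ℝ) • e y + (2 : ℝ) • d y - c y := by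
          simp only [Pi.add_apply, hd, hc, two_smul]
          abel
        rw [hsum, pressureForm_sub_right, pressureForm_add_right, pressureForm_smul_right,
          pressureForm_smul_right]
        rfl
      have hI12 : IntegrableOn (fun y => 2 * pressureForm (x - y) (c y) (e y) + 2 * pressureForm (x - y) (c y) (d y))
          (closedBall x ε)ᶜ volume := (hI₁.const_mul 2).add (hI₂.const_mul 2)
      rw [integral_congr_ae (Eventually.of_forall hpt), integral_sub hI12 hI₃,
        integral_add (hI₁.const_mul 2) (hI₂.const_mul 2), integral_const_mul, integral_const_mul]
    -- pass to the limit `ε → 0⁺`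
    have hlim : Tendsto (fun ε => truncatedPressureIntegral a x ε - truncatedPressureIntegral b x ε) (𝓝[>] 0)
        (𝓝 (2 * P₁ x + 2 * P₂ x - P₃ x)) := by
      have h := ((hx₁.const_mul 2).add (hx₂.const_mul 2)).sub hx₃
      refine h.congr' ?_
      filter_upwards [self_mem_nhdsWithin] with ε hε
      exact (htrunc ε hε).symm
    have hlim' : Tendsto (fun ε => truncatedPressureIntegral a x ε - truncatedPressureIntegral b x ε) (𝓝[>] 0)
        (𝓝 (La - Lb)) := hLa.2.sub hLb.2
    have hLL : La - Lb = 2 * P₁ x + 2 * P₂ x - P₃ x := tendsto_nhds_unique hlim' hlim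
    rw [normalisedPressure_sub_eq hLa hLb, hLL, norm_sq_sub_norm_sq_eq_inner]
    have hsum : a x + b x = (2 : ℝ) • e x + (2 : ℝ) • d x - c x := by
      simp only [hd, hc, two_smul]
      abel
    have hcx : a x - b x = c x := rfl
    rw [hcx, hsum, inner_sub_right, inner_add_right, real_inner_smul_right, real_inner_smul_right]
    simp only [hQ₁, hQ₂, hQ₃]
    ring
  · -- ## `‖Q₁‖₂`
    have hm1 : AEStronglyMeasurable (fun x => -(2 * 3⁻¹) * ⟪c x, e x⟫) volume := (hcm.inner he).const_mul _
    have hm2 : AEStronglyMeasurable (fun x => 2 * P₁ x) volume := hP₁m.const_mul _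
    calc eLpNorm Q₁ 2 volume ≤ eLpNorm (fun x => -(2 * 3⁻¹) * ⟪c x, e x⟫) 2 volume + eLpNorm (fun x => 2 * P₁ x) 2 volume :=
          eLpNorm_add_le hm1 hm2 one_le_two
      _ ≤ 2 * 3⁻¹ * eLpNorm (fun y => ‖c y‖ * ‖e y‖) 2 volume + 2 * (K₂ * eLpNorm (fun y => ‖c y‖ * ‖e y‖) 2 volume) := by
          gcongr
          · have e1 : (fun x => -(2 * 3⁻¹) * ⟪c x, e x⟫) = (-(2 * 3⁻¹) : ℝ) • fun x => ⟪c x, e x⟫ := by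
              funext x; simp only [Pi.smul_apply, smul_eq_mul]
            rw [e1, eLpNorm_const_smul, enorm_neg, Real.enorm_eq_ofReal (by norm_num),
              ENNReal.ofReal_mul zero_le_two, ENNReal.ofReal_inv_of_pos (by norm_num), ENNReal.ofReal_ofNat,
              ENNReal.ofReal_ofNat]
            exact mul_le_mul' le_rfl (eLpNorm_inner_le c e 2)
          · have e2 : (fun x => 2 * P₁ x) = (2 : ℝ) • P₁ := by
              funext x; simp only [Pi.smul_apply, smul_eq_mul]
            rw [e2, eLpNorm_const_smul, Real.enorm_eq_ofReal zero_le_two, ENNReal.ofReal_ofNat]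
            exact mul_le_mul' le_rfl hP₁b
      _ ≤ C * eLpNorm (fun y => ‖c y‖ * ‖e y‖) 2 volume := by
          rw [← mul_assoc, ← add_mul]
          refine mul_le_mul' ?_ le_rfl
          simp only [hC]
          exact le_add_right le_rfl
  · -- ## `‖Q₂‖₂`
    have hm1 : AEStronglyMeasurable (fun x => -(2 * 3⁻¹) * ⟪c x, d x⟫) volume := (hcm.inner hdm).const_mul _
    have hm2 : AEStronglyMeasurable (fun x => 2 * P₂ x) volume := hP₂m.const_mul _
    calc eLpNorm Q₂ 2 volume ≤ eLpNorm (fun x => -(2 * 3⁻¹) * ⟪c x, d x⟫) 2 volume + eLpNorm (fun x => 2 * P₂ x) 2 volume :=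
          eLpNorm_add_le hm1 hm2 one_le_two
      _ ≤ 2 * 3⁻¹ * eLpNorm (fun y => ‖c y‖ * ‖d y‖) 2 volume + 2 * (K₂ * eLpNorm (fun y => ‖c y‖ * ‖d y‖) 2 volume) := by
          gcongr
          · have e1 : (fun x => -(2 * 3⁻¹) * ⟪c x, d x⟫) = (-(2 * 3⁻¹) : ℝ) • fun x => ⟪c x, d x⟫ := by
              funext x; simp only [Pi.smul_apply, smul_eq_mul]
            rw [e1, eLpNorm_const_smul, enorm_neg, Real.enorm_eq_ofReal (by norm_num),
              ENNReal.ofReal_mul zero_le_two, ENNReal.ofReal_inv_of_pos (by norm_num), ENNReal.ofReal_ofNat,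
              ENNReal.ofReal_ofNat]
            exact mul_le_mul' le_rfl (eLpNorm_inner_le c d 2)
          · have e2 : (fun x => 2 * P₂ x) = (2 : ℝ) • P₂ := by
              funext x; simp only [Pi.smul_apply, smul_eq_mul]
            rw [e2, eLpNorm_const_smul, Real.enorm_eq_ofReal zero_le_two, ENNReal.ofReal_ofNat]
            exact mul_le_mul' le_rfl hP₂b
      _ ≤ C * eLpNorm (fun y => ‖c y‖ * ‖d y‖) 2 volume := by
          rw [← mul_assoc, ← add_mul]
          refine mul_le_mul' ?_ le_rfl
          simp only [hC]
          exact le_add_right le_rfl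
  · -- ## `‖Q₃‖_{3/2}`
    have hm1 : AEStronglyMeasurable (fun x => 3⁻¹ * ⟪c x, c x⟫) volume := (hcm.inner hcm).const_mul _
    have h1le : (1 : ℝ≥0∞) ≤ 3 / 2 := h32_1.le
    calc eLpNorm Q₃ (3 / 2 : ℝ≥0∞) volume
        ≤ eLpNorm (fun x => 3⁻¹ * ⟪c x, c x⟫) (3 / 2 : ℝ≥0∞) volume + eLpNorm P₃ (3 / 2 : ℝ≥0∞) volume :=
          eLpNorm_sub_le hm1 hP₃m h1le
      _ ≤ 3⁻¹ * eLpNorm (fun y => ‖c y‖ * ‖c y‖) (3 / 2 : ℝ≥0∞) volume +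
            K₃ * eLpNorm (fun y => ‖c y‖ * ‖c y‖) (3 / 2 : ℝ≥0∞) volume := by
          gcongr
          · have e1 : (fun x => 3⁻¹ * ⟪c x, c x⟫) = (3⁻¹ : ℝ) • fun x => ⟪c x, c x⟫ := by
              funext x; simp only [Pi.smul_apply, smul_eq_mul]
            rw [e1, eLpNorm_const_smul, Real.enorm_eq_ofReal (by norm_num),
              ENNReal.ofReal_inv_of_pos (by norm_num), ENNReal.ofReal_ofNat]
            exact mul_le_mul' le_rfl (eLpNorm_inner_le c c _)
      _ ≤ C * eLpNorm (fun y => ‖c y‖ ^ 2) (3 / 2 : ℝ≥0∞) volume := by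
          rw [← add_mul, eLpNorm_norm_sq_eq_eLpNorm_norm_mul_norm]
          refine mul_le_mul' ?_ le_rfl
          simp only [hC]
          exact le_add_self

end Difference

end Literature.Analysis.FluidPDE
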